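import Summits.ResolutionOfSingularities.ResolutionOfSingularities.Theorems.PurelyInseparableDim4ResConeNear
import Summits.ResolutionOfSingularities.ResolutionOfSingularities.Theorems.PurelyInseparableDim4ResConeSatLocated
import Summits.ResolutionOfSingularities.ResolutionOfSingularities.Theorems.PurelyInseparableDim4ResConeSatUnique
import Summits.ResolutionOfSingularities.ResolutionOfSingularities.Theorems.PurelyInseparableDim4BandShade
import Summits.ResolutionOfSingularities.ResolutionOfSingularities.Theorems.PurelyInseparableDim4SwapTransportReadTwo
import HarnessLib
import HarnessLib.Audit.Tags

/-!
# Purely inseparable four-folds — THE LIGHT-PAIR KERNEL RIGIDITY (slice C, `(5,4)` light pair, hN4-C′ tools): a LOSS-FREE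
# translation whose direction lies in the polar kernel is UNIQUE under TT, and TT rides slot steps
# (cell `res-dim4-pi`, K2(p) lane, slice C; hN4-C′ = light-pair `(5,4)` re-presentation, file 1)

[OURS · counted 0 · cell `res-dim4-pi` · K2(p) lane; LEDGER THEOREM v8 (res-dim4-p-12 g4, p704409) names hN4-C′ «light-pair (5,4)
re-presentation (p-3 g4 / p-5 direct)»; route = res-dim4-p-1 g5's LIGHT-LOSSY idea (kernel-determined translation, bus
2026-08-29 06:53:52Z) in res-dim4-typ-1 g3's `ℛ²` dress, with res-dim4-p-5 g4's TT («tilt persists», `…ResConeTTPersist`);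
seat res-dim4-p-3 g4.]  Nothing here proves K2(p)/K2(5), `NoIsolatedTrap 5 5`, TAIL-D or resolution of singularities in
dimension ≥ 4 / characteristic `p` — NOT proved.  AI kernel work, weaker than expert review.

THE POINT.  An honest (`M`-independent) re-presentation of a light-pair chain needs, at each virtual step, a translation `β`
supported on the two free letters that does not depend on the precision `M` of the `ℛ²`-relation it was solved from (Cramer
on a 1-jet known only through an `∃`).  Rigidity: the virtual step keeps the shade, so `direction ℓ β ∈ resVertex B`
(`direction_mem_resVertex_of_shade_eq`, tree); and if the polar kernel `resVertex B` (dimension `e_G = 2`) contains no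
non-zero vector vanishing on both slots — **TT(B)(a, a′)** — two such loss-free translations coincide.  TT rides every
SLOT step (`resVertex_step_inf_hyperplane_le_resVertex`, tree), and all virtual steps are slot steps.
* `translation_eq_of_TT` — uniqueness.
* `lightPair_shade_step_eq` — a light-pair step between order-`6` states with `|r| = 2` keeps the shade (`= 4`).
* `lightPair_direction_mem_resVertex` — hence its direction lies in the polar kernel.
* `lightPair_TT_step` — TT(a, a′) passes to the child of a slot step `ℓ ∈ {a, a′}`.
* `lightPair_translation_unique` — the package: two loss-free slot steps from the same TT state, both landing at order `6` with
  ledger `x_a x_{a′}`, have the same translation.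
* `lightPair_rel_refl` — the identity `ℛ²`-relation of a clean state to itself along `π = 1` (entry of the forward construction).

[cite: CossartJannsenSaito2020, Thm. 3.10(4), Thm. 3.14] [cite: Hauser2010, §§F–G]
bears_on: LADDER-RESOLUTION:D157-DOOR2 (res-dim4-pi · K2(p) slice C · hN4-C′ file 1).
Supports stmt-ResolutionOfSingularities-16155 (helper).
-/

set_option linter.dupNamespace false -- mandated namespace of this single-conjunct summit

noncomputable section

namespace Summit.ResolutionOfSingularities.ResolutionOfSingularities.Theorems.PIDim4

namespace ResCone

open MvPolynomial Finset
open Literature.AlgebraicGeometry.Resolution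
open Literature.AlgebraicGeometry.Resolution.CentreBlowup
open Literature.AlgebraicGeometry.Resolution.Hauser2010
open Literature.AlgebraicGeometry.Resolution.HauserPerlega2019
open PointBlowup (direction)

variable {K : Type} [Field K]

/-! ## §1 Uniqueness of the loss-free kernel translation -/

/-- **UNIQUENESS UNDER TT**: if `resVertex B` has no non-zero vector vanishing on both slots `a, a′`, two translations
supported off `{a, a′}` (and off the chart `ℓ ∈ {a, a′}`) whose directions both lie in `resVertex B` are EQUAL. [OURS] -/
theorem translation_eq_of_TT {B : State K} {a a' ℓ : Fin 4}
    (hTT : ∀ v ∈ resVertex B, v a = 0 → v a' = 0 → v = 0) (hℓ : ℓ = a ∨ ℓ = a') {β β' : Fin 4 → K}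
    (hβa : β a = 0) (hβa' : β a' = 0) (hβ'a : β' a = 0) (hβ'a' : β' a' = 0)
    (hβ : direction ℓ β ∈ resVertex B) (hβ' : direction ℓ β' ∈ resVertex B) : β = β' := by
  have hv := hTT _ (Submodule.sub_mem _ hβ hβ') ?_ ?_
  · funext i
    by_cases hi : i = ℓ
    · subst hi
      rcases hℓ with rfl | rfl
      · rw [hβa, hβ'a]
      · rw [hβa', hβ'a']
    · have h := congrFun hv i
      rw [Pi.sub_apply, Pi.zero_apply, direction_apply_of_ne hi, direction_apply_of_ne hi, sub_eq_zero] at h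
      exact h
  · rw [Pi.sub_apply]
    by_cases h : a = ℓ
    · subst h; rw [direction_apply_self, direction_apply_self, sub_self]
    · rw [direction_apply_of_ne h, direction_apply_of_ne h, hβa, hβ'a, sub_self]
  · rw [Pi.sub_apply]
    by_cases h : a' = ℓ
    · subst h; rw [direction_apply_self, direction_apply_self, sub_self]
    · rw [direction_apply_of_ne h, direction_apply_of_ne h, hβa', hβ'a', sub_self]

/-! ## §2 A light-pair step keeps the shade; its direction is a kernel vector; TT rides slot steps -/

/-- The weight vector `x_a x_{a′}` has degree `2`. [folklore] -/
theorem degree_pair_eq_two {a a' : Fin 4} : (Finsupp.single a 1 + Finsupp.single a' 1 : Fin 4 →₀ ℕ).degree = 2 := by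
  rw [map_add, Finsupp.degree_single, Finsupp.degree_single]

/-- **A light-pair step keeps the shade**: between two states of order `6` with two weight-`1` letters each, the shade is
`4` on both sides. [folklore] [cite: CossartJannsenSaito2020, Thm. 3.14] -/
theorem lightPair_shade_step_eq [DecidableEq K] {s : State K} {ℓ : Fin 4} {β : Fin 4 → K} {a a' x x' : Fin 4}
    (ho : ordZero s.F = 6) (hr : s.r = Finsupp.single a 1 + Finsupp.single a' 1)
    (ho' : ordZero (CentreBlowup.step 5 Finset.univ ℓ β s).F = 6)
    (hr' : (CentreBlowup.step 5 Finset.univ ℓ β s).r = Finsupp.single x 1 + Finsupp.single x' 1) :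
    (CentreBlowup.step 5 Finset.univ ℓ β s).shade = s.shade := by
  have h1 := BandShade.shade_eq_coe ho'
  have h2 := BandShade.shade_eq_coe ho
  rw [hr'] at h1
  rw [hr] at h2
  rw [degree_pair_eq_two] at h1 h2
  exact h1.trans h2.symm

/-- **The direction of a light-pair step is a polar-kernel vector** (`x^r ∣ F` at the source). [OURS]
[cite: CossartJannsenSaito2020, Thm. 3.14] -/
theorem lightPair_direction_mem_resVertex [DecidableEq K] {s : State K} {ℓ : Fin 4} {β : Fin 4 → K}
    {a a' x x' : Fin 4} (hβℓ : β ℓ = 0) (ho : ordZero s.F = 6) (hdiv : ∀ d ∈ s.F.support, s.r ≤ d)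
    (hr : s.r = Finsupp.single a 1 + Finsupp.single a' 1) (ho' : ordZero (CentreBlowup.step 5 Finset.univ ℓ β s).F = 6)
    (hr' : (CentreBlowup.step 5 Finset.univ ℓ β s).r = Finsupp.single x 1 + Finsupp.single x' 1) :
    direction ℓ β ∈ resVertex s :=
  direction_mem_resVertex_of_shade_eq (q := 5) ℓ hβℓ ho hdiv (by norm_num) (by norm_num)
    (lightPair_shade_step_eq ho hr ho' hr')

/-- **TT RIDES SLOT STEPS**: if `resVertex s` has no non-zero vector vanishing on `a, a′` and the light-pair step is taken in a
slot chart `ℓ ∈ {a, a′}`, the child's polar kernel has the same property (res-dim4-p-5 g4's `tt_succ`, state level). [OURS]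
[cite: CossartJannsenSaito2020, Thm. 3.10(4)] -/
theorem lightPair_TT_step [DecidableEq K] {s : State K} {ℓ : Fin 4} {β : Fin 4 → K} {a a' x x' : Fin 4}
    (hℓ : ℓ = a ∨ ℓ = a') (hβℓ : β ℓ = 0) (ho : ordZero s.F = 6) (hdiv : ∀ d ∈ s.F.support, s.r ≤ d)
    (hr : s.r = Finsupp.single a 1 + Finsupp.single a' 1) (ho' : ordZero (CentreBlowup.step 5 Finset.univ ℓ β s).F = 6)
    (hr' : (CentreBlowup.step 5 Finset.univ ℓ β s).r = Finsupp.single x 1 + Finsupp.single x' 1)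
    (hTT : ∀ v ∈ resVertex s, v a = 0 → v a' = 0 → v = 0) :
    ∀ v ∈ resVertex (CentreBlowup.step 5 Finset.univ ℓ β s), v a = 0 → v a' = 0 → v = 0 := by
  intro v hv hva hva'
  have hvℓ : v ℓ = 0 := by
    rcases hℓ with rfl | rfl
    · exact hva
    · exact hva'
  have h := resVertex_step_inf_hyperplane_le_resVertex (q := 5) ℓ hβℓ ho hdiv (by norm_num) (by norm_num)
    (lightPair_shade_step_eq ho hr ho' hr') (Submodule.mem_inf.mpr ⟨hv, mem_hyperplane.mpr hvℓ⟩)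
  exact hTT v (Submodule.mem_inf.mp h).1 hva hva'

/-- **THE LIGHT-PAIR TRANSLATION IS UNIQUE**: from a TT state of order `6` with ledger `x_a x_{a′} ∣ F`, two loss-free slot steps
in the same chart `ℓ ∈ {a, a′}` (translations off `{a, a′}`) that both land at order `6` with a two-letter ledger have the SAME
translation. [OURS] [cite: CossartJannsenSaito2020, Thm. 3.14] -/
theorem lightPair_translation_unique [DecidableEq K] {s : State K} {ℓ a a' : Fin 4} (hℓ : ℓ = a ∨ ℓ = a')
    (ho : ordZero s.F = 6) (hdiv : ∀ d ∈ s.F.support, s.r ≤ d) (hr : s.r = Finsupp.single a 1 + Finsupp.single a' 1)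
    (hTT : ∀ v ∈ resVertex s, v a = 0 → v a' = 0 → v = 0) {β β' : Fin 4 → K} (hβa : β a = 0) (hβa' : β a' = 0)
    (hβ'a : β' a = 0) (hβ'a' : β' a' = 0) {x x' y y' : Fin 4}
    (ho₁ : ordZero (CentreBlowup.step 5 Finset.univ ℓ β s).F = 6)
    (hr₁ : (CentreBlowup.step 5 Finset.univ ℓ β s).r = Finsupp.single x 1 + Finsupp.single x' 1)
    (ho₂ : ordZero (CentreBlowup.step 5 Finset.univ ℓ β' s).F = 6)
    (hr₂ : (CentreBlowup.step 5 Finset.univ ℓ β' s).r = Finsupp.single y 1 + Finsupp.single y' 1) : β = β' := by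
  have hβℓ : β ℓ = 0 := by
    rcases hℓ with rfl | rfl
    · exact hβa
    · exact hβa'
  have hβ'ℓ : β' ℓ = 0 := by
    rcases hℓ with rfl | rfl
    · exact hβ'a
    · exact hβ'a'
  exact translation_eq_of_TT hTT hℓ hβa hβa' hβ'a hβ'a' (lightPair_direction_mem_resVertex hβℓ ho hdiv hr ho₁ hr₁)
    (lightPair_direction_mem_resVertex hβ'ℓ ho hdiv hr ho₂ hr₂)

/-! ## §3 The identity relation (entry of the forward construction) -/

/-- **The identity `ℛ²`-relation** of a clean state to itself along `π = 1` (`θ = X`, `e = 1`, `U = 1`, `E = 0`), in the binder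
shape of res-dim4-typ-1 g3's window core. [folklore] -/
theorem lightPair_rel_refl {A : State K} (hclean : deletePthPowers 5 A.F = A.F) {a a' u f : Fin 4} (hau : a ≠ u)
    (haf : a ≠ f) (ha'u : a' ≠ u) (ha'f : a' ≠ f) (huf : u ≠ f) (M : ℕ) :
    ∃ (θ e : Fin 4 → MvPolynomial (Fin 4) K) (U E : MvPolynomial (Fin 4) K),
      θ ((1 : Equiv.Perm (Fin 4)) a) = X a * e a ∧ θ ((1 : Equiv.Perm (Fin 4)) a') = X a' * e a' ∧
      constantCoeff (e a) ≠ 0 ∧ constantCoeff (e a') ≠ 0 ∧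
      constantCoeff (θ ((1 : Equiv.Perm (Fin 4)) u)) = 0 ∧ constantCoeff (θ ((1 : Equiv.Perm (Fin 4)) f)) = 0 ∧
      coeff (Finsupp.single u 1) (θ ((1 : Equiv.Perm (Fin 4)) u)) * coeff (Finsupp.single f 1) (θ ((1 : Equiv.Perm (Fin 4)) f)) -
        coeff (Finsupp.single f 1) (θ ((1 : Equiv.Perm (Fin 4)) u)) *
          coeff (Finsupp.single u 1) (θ ((1 : Equiv.Perm (Fin 4)) f)) ≠ 0 ∧
      constantCoeff U ≠ 0 ∧ E ∈ originIdeal K ^ M ∧ A.F = deletePthPowers 5 (U ^ 5 * aeval θ A.F) + E := by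
  have _ := hau; have _ := haf; have _ := ha'u; have _ := ha'f
  have h1 : coeff (Finsupp.single f 1) (X u : MvPolynomial (Fin 4) K) = 0 := by
    rw [coeff_X, if_neg]; exact fun h => huf (Finsupp.single_left_injective one_ne_zero h)
  refine ⟨X, fun _ => 1, 1, 0, ?_, ?_, ?_, ?_, ?_, ?_, ?_, ?_, Submodule.zero_mem _, ?_⟩
  · rw [Equiv.Perm.one_apply, mul_one]
  · rw [Equiv.Perm.one_apply, mul_one]
  · rw [map_one]; exact one_ne_zero
  · rw [map_one]; exact one_ne_zero
  · rw [Equiv.Perm.one_apply]; exact constantCoeff_X (R := K) u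
  · rw [Equiv.Perm.one_apply]; exact constantCoeff_X (R := K) f
  · rw [Equiv.Perm.one_apply, Equiv.Perm.one_apply, coeff_X_same, coeff_X_same, h1, zero_mul, sub_zero, mul_one]
    exact one_ne_zero
  · rw [map_one]; exact one_ne_zero
  · rw [one_pow, one_mul, MvPolynomial.aeval_X_left, AlgHom.id_apply, hclean, add_zero]

end ResCone

end Summit.ResolutionOfSingularities.ResolutionOfSingularities.Theorems.PIDim4

end
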